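import Literature.NumberTheory.Sieve.LargestPrimeFactorCubicKProduct
import HarnessLib

/-!
# Heath-Brown 2001 (PLMS), Lemma 11, (7.5): the tail `∑_{d>Δ} (r,d)/d² ≤ 2τ(r)/Δ`

Topic `Literature/NumberTheory/Sieve`; a PROVED elementary layer (no named facts) under the named fact
`Irving2015_largestPrimeFactor_cubic` (`LargestPrimeFactorCubic.lean`), an input of Heath-Brown's
**Lemma 11** (main-term programme, Lemma 7).  Source: D. R. Heath-Brown, *The largest prime factor of
`X³ + 2`*, Proc. London Math. Soc. (3) 82 (2001) 554–596, §7 pp. 25–26, (7.5): the terms `d > Δ` of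
the main-term series (7.4) contribute "`≪ ∑_{N(R)≤Q} (M²/N(R)) ∑_{d>Δ} d⁻² N((R,d))` … We put
`(R, d) = S` … on setting `d = N(S)e`, the above becomes `≪ M² ∑ N(S)⁻² N(T)⁻¹ ∑_{e>Δ/N(S)} e⁻² ≪
M² ∑ N(S)⁻² N(T)⁻¹ min{1, N(S)/Δ} ≪ M²Δ⁻¹(log N)²`."  In root language `N((R,d)) = (r, d)`; we
PROVE the corresponding elementary bound, grouping `d` by the divisor `s = (r, d)` of `r`:

  **`sum_Ioc_gcd_div_sq_le`**: `∑_{Δ < d ≤ D} (r,d)/d² ≤ 2 τ(r)/Δ`  (`r, Δ ≥ 1`),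

from `∑_{e > k} e⁻² ≤ 1/k` (`…KProduct.sum_Ioc_inv_sq_le`) and `∑_{e ≥ 1} e⁻² ≤ 2`.

## References

* D. R. Heath-Brown, *The largest prime factor of `X³ + 2`*, Proc. London Math. Soc. (3) 82 (2001)
  554–596, §7 (7.5) pp. 25–26. [`HeathBrown2001LargestPrimeFactorCubic`]

## Mathlib / tree search

Tree: `HeathBrown2001.sum_Ioc_inv_sq_le` (`…KProduct`).  Mathlib: `Finset.sum_fiberwise_of_maps_to`,
`Nat.gcd_dvd_left`, `Nat.div_mul_cancel`.
-/

noncomputable section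

open Finset

namespace Literature.NumberTheory.Sieve.HeathBrown2001

/-- `∑_{1 ≤ e ≤ N} 1/e² ≤ 2`. [folklore] -/
theorem sum_Icc_inv_sq_le_two (N : ℕ) : ∑ e ∈ Icc 1 N, 1 / (e : ℝ) ^ 2 ≤ 2 := by
  rcases Nat.eq_zero_or_pos N with rfl | hN
  · simp
  have : Icc 1 N = insert 1 (Ioc 1 N) := by
    ext e; simp only [mem_Icc, mem_insert, mem_Ioc]; omega
  rw [this, sum_insert (by simp)]
  have h := sum_Ioc_inv_sq_le (le_refl 1) N
  norm_num at h ⊢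
  linarith

/-- For `s ≥ 1`, `Δ ≥ 1`: `∑_{Δ < d ≤ D, s ∣ d} 1/d² ≤ 2/(sΔ)` (substituting `d = se`). [folklore] -/
theorem sum_Ioc_filter_dvd_inv_sq_le {s Δ : ℕ} (hs : 0 < s) (hΔ : 0 < Δ) (D : ℕ) :
    ∑ d ∈ (Ioc Δ D).filter (fun d => s ∣ d), 1 / (d : ℝ) ^ 2 ≤ 2 / ((s : ℝ) * Δ) := by
  have hs' : (0 : ℝ) < s := by exact_mod_cast hs
  have hΔ' : (0 : ℝ) < Δ := by exact_mod_cast hΔ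
  -- reindex by `e = d / s ∈ (Δ/s, D/s]`
  have himg : (Ioc Δ D).filter (fun d => s ∣ d) ⊆ (Ioc (Δ / s) (D / s)).image (fun e => s * e) := by
    intro d hd
    rw [mem_filter, mem_Ioc] at hd
    obtain ⟨⟨h1, h2⟩, ⟨e, rfl⟩⟩ := hd
    rw [mem_image]
    refine ⟨e, ?_, rfl⟩
    rw [mem_Ioc, Nat.div_lt_iff_lt_mul hs, Nat.le_div_iff_mul_le hs]
    constructor <;> linarith [mul_comm s e]
  have hle : ∑ d ∈ (Ioc Δ D).filter (fun d => s ∣ d), 1 / (d : ℝ) ^ 2 ≤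
      ∑ e ∈ Ioc (Δ / s) (D / s), 1 / ((s : ℝ) * e) ^ 2 := by
    calc ∑ d ∈ (Ioc Δ D).filter (fun d => s ∣ d), 1 / (d : ℝ) ^ 2
        ≤ ∑ d ∈ (Ioc (Δ / s) (D / s)).image (fun e => s * e), 1 / (d : ℝ) ^ 2 :=
          sum_le_sum_of_subset_of_nonneg himg fun _ _ _ => by positivity
      _ = ∑ e ∈ Ioc (Δ / s) (D / s), 1 / (((s * e : ℕ)) : ℝ) ^ 2 :=
          sum_image fun x _ y _ h => Nat.eq_of_mul_eq_mul_left hs h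
      _ = ∑ e ∈ Ioc (Δ / s) (D / s), 1 / ((s : ℝ) * e) ^ 2 := by push_cast; rfl
  refine hle.trans ?_
  have e1 : ∑ e ∈ Ioc (Δ / s) (D / s), 1 / ((s : ℝ) * e) ^ 2 = (1 / (s : ℝ) ^ 2) * ∑ e ∈ Ioc (Δ / s) (D / s), 1 / (e : ℝ) ^ 2 := by
    rw [mul_sum]; exact sum_congr rfl fun e _ => by rw [mul_pow]; field_simp
  rw [e1]
  rcases Nat.eq_zero_or_pos (Δ / s) with h0 | hpos
  · -- `s > Δ`: use `∑_{e ≥ 1} ≤ 2` and `1/s² ≤ 1/(sΔ)`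
    have hsΔ : Δ < s := by rwa [Nat.div_eq_zero_iff_lt hs] at h0
    have hsΔ' : (Δ : ℝ) ≤ s := by exact_mod_cast hsΔ.le
    rw [h0]
    have h2 : ∑ e ∈ Ioc 0 (D / s), 1 / (e : ℝ) ^ 2 ≤ 2 := by
      rw [show Ioc 0 (D / s) = Icc 1 (D / s) by ext e; simp only [mem_Ioc, mem_Icc]; omega]
      exact sum_Icc_inv_sq_le_two _
    calc 1 / (s : ℝ) ^ 2 * ∑ e ∈ Ioc 0 (D / s), 1 / (e : ℝ) ^ 2 ≤ 1 / (s : ℝ) ^ 2 * 2 := by gcongr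
      _ ≤ 2 / ((s : ℝ) * Δ) := by
          rw [div_mul_eq_mul_div, one_mul, div_le_div_iff₀ (by positivity) (by positivity)]
          nlinarith
  · -- `s ≤ Δ`: `∑_{e > Δ/s} e⁻² ≤ 1/(Δ/s) ≤ 2s/Δ`
    have h1 := sum_Ioc_inv_sq_le hpos (D / s)
    have hk : (Δ : ℝ) / s ≤ 2 * ((Δ / s : ℕ) : ℝ) := by
      have hmod : Δ = s * (Δ / s) + Δ % s := (Nat.div_add_mod Δ s).symm
      have hlt : Δ % s < s := Nat.mod_lt _ hs
      have : (Δ : ℝ) = s * ((Δ / s : ℕ) : ℝ) + ((Δ % s : ℕ) : ℝ) := by exact_mod_cast hmod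
      rw [div_le_iff₀ hs', this]
      have h1' : (1 : ℝ) ≤ ((Δ / s : ℕ) : ℝ) := by exact_mod_cast hpos
      have : ((Δ % s : ℕ) : ℝ) ≤ s := by exact_mod_cast hlt.le
      nlinarith
    have hpos' : (0 : ℝ) < ((Δ / s : ℕ) : ℝ) := by exact_mod_cast hpos
    calc 1 / (s : ℝ) ^ 2 * ∑ e ∈ Ioc (Δ / s) (D / s), 1 / (e : ℝ) ^ 2
        ≤ 1 / (s : ℝ) ^ 2 * (1 / ((Δ / s : ℕ) : ℝ)) := by gcongr
      _ ≤ 2 / ((s : ℝ) * Δ) := by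
          rw [div_mul_div_comm, one_mul, div_le_div_iff₀ (by positivity) (by positivity)]
          have : (Δ : ℝ) ≤ 2 * ((Δ / s : ℕ) : ℝ) * s := by
            rw [div_le_iff₀ hs'] at hk; linarith
          nlinarith

/-- **(7.5) in root language**: `∑_{Δ < d ≤ D} (r,d)/d² ≤ 2τ(r)/Δ` for `r, Δ ≥ 1`.
[cite: HeathBrown2001LargestPrimeFactorCubic, §7 (7.5) pp. 25–26] -/
theorem sum_Ioc_gcd_div_sq_le {r Δ : ℕ} (hr : 0 < r) (hΔ : 0 < Δ) (D : ℕ) :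
    ∑ d ∈ Ioc Δ D, (Nat.gcd r d : ℝ) / (d : ℝ) ^ 2 ≤ 2 * (#r.divisors : ℝ) / Δ := by
  classical
  have hΔ' : (0 : ℝ) < Δ := by exact_mod_cast hΔ
  -- group by `s = (r, d) ∈ r.divisors`
  have hmaps : ∀ d ∈ Ioc Δ D, Nat.gcd r d ∈ r.divisors := fun d _ =>
    Nat.mem_divisors.mpr ⟨Nat.gcd_dvd_left r d, hr.ne'⟩
  rw [← sum_fiberwise_of_maps_to hmaps]
  have hfib : ∀ s ∈ r.divisors, ∑ d ∈ (Ioc Δ D).filter (fun d => Nat.gcd r d = s),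
      (Nat.gcd r d : ℝ) / (d : ℝ) ^ 2 ≤ 2 / Δ := by
    intro s hs
    have hs0 : 0 < s := Nat.pos_of_mem_divisors hs
    have hs' : (0 : ℝ) < s := by exact_mod_cast hs0
    calc ∑ d ∈ (Ioc Δ D).filter (fun d => Nat.gcd r d = s), (Nat.gcd r d : ℝ) / (d : ℝ) ^ 2
        = ∑ d ∈ (Ioc Δ D).filter (fun d => Nat.gcd r d = s), (s : ℝ) * (1 / (d : ℝ) ^ 2) := by
          refine sum_congr rfl fun d hd => ?_
          rw [mem_filter] at hd; rw [hd.2]; ring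
      _ ≤ ∑ d ∈ (Ioc Δ D).filter (fun d => s ∣ d), (s : ℝ) * (1 / (d : ℝ) ^ 2) := by
          refine sum_le_sum_of_subset_of_nonneg (fun d hd => ?_) fun _ _ _ => by positivity
          rw [mem_filter] at hd ⊢
          exact ⟨hd.1, hd.2 ▸ Nat.gcd_dvd_right r d⟩
      _ = (s : ℝ) * ∑ d ∈ (Ioc Δ D).filter (fun d => s ∣ d), 1 / (d : ℝ) ^ 2 := by rw [mul_sum]
      _ ≤ (s : ℝ) * (2 / ((s : ℝ) * Δ)) := by gcongr; exact sum_Ioc_filter_dvd_inv_sq_le hs0 hΔ D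
      _ = 2 / Δ := by field_simp
  calc ∑ s ∈ r.divisors, ∑ d ∈ (Ioc Δ D).filter (fun d => Nat.gcd r d = s), (Nat.gcd r d : ℝ) / (d : ℝ) ^ 2
      ≤ ∑ _s ∈ r.divisors, (2 : ℝ) / Δ := sum_le_sum hfib
    _ = 2 * (#r.divisors : ℝ) / Δ := by rw [sum_const, nsmul_eq_mul]; ring

end Literature.NumberTheory.Sieve.HeathBrown2001
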